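import Summits.SmoothPoincare4.SmoothPoincare4.Theses.HyperbolicTorusFillings
import Literature.Topology.FourManifolds.TorusSurgery
import HarnessLib
import HarnessLib.Audit

/-!
# Birth skeleton (BC3) for crux `HyperbolicTorusFillings.SingleLinkGeneration` (item stmt-SmoothPoincare4-3358)

`Cruxes/SingleLinkGeneration/Lines/birth.lean` · registrar planner-skel-stmt-SmoothPoincare4-3358-0 ·
2026-08-17 · mode skeleton-register (route re-audit bin REPAIRABLE; route
`route-SmoothPoincare4-HyperbolicTorusFillings`, crux rank 3). The crux is FIXED and is concluded BY NAME:

  `Summit.SmoothPoincare4.SmoothPoincare4.Theses.HyperbolicTorusFillings.SingleLinkGeneration`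

SINGLE LINK GENERATION (Larson 2018, Question 1, restricted to homotopy spheres): every smooth homotopy
4-sphere `Σ = (M, e : M ≃ₕ S⁴)` is ONE simultaneous torus surgery on a framed link of tori in `S⁴`:
`∃ n T A, IsTorusLinkSurgery (𝓡 4) M n T A` (the crux inlines the body of the tree predicate
`Literature.Topology.FourManifolds.IsTorusLinkSurgery`; `isTorusLinkSurgery_iff` is `Iff.rfl`).

## The cut — "common child, disjoin the two core links, reverse and unite"

What is KNOWN (Baykur–Sunukjian 2013, Cor. 10–11 and the paragraph after Prop. 13; Larson 2018 §1): every
`(χ, σ) = (2, 0)` manifold, in particular every homotopy 4-sphere `M`, is reached from `S⁴` by a SEQUENCE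
of torus surgeries, and for homotopy spheres the sequence has length two with a very special shape:
Wall's theorem (tree: `Literature.Topology.FourManifolds.exists_isStabilization_sphere_of_homotopySphere_four`,
from the named facts `exists_isStabilization_of_isHCobordant` = Wall 1964 Thm 3 and `Θ₄ = 0`) gives
`M # k(S² × S²) ≅ # k(S² × S²)`, hence `M # k W ≅ S⁴ # k W =: N` with `W = S² × S² # S¹ × S³`; and
`X ↦ X # W` is a multiplicity-`0` torus surgery on an UNKNOTTED torus inside a `4`-ball of `X`
(Baykur–Sunukjian 2013 Prop. 13 "stabilising with `S² × S² # S¹ × S³` is a log transform"; Larson 2018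
Thm. 20 = Pao / Iwase: `S⁴_𝒯(0,a,b) ≅ S¹ × S³ # S² × S²` for the unknotted torus `𝒯`, `ab` even). So the
middle level `N` is a COMMON CHILD: it is a torus surgery on `S⁴` along `k` unknotted tori in disjoint
balls, and — transporting through Wall's diffeomorphism — a torus surgery on `M` along `k` unknotted tori
in disjoint balls of `M`. Reversing the `M`-side surgery (a torus surgery is undone by the surgery on its
core tori) exhibits `M` as the second round `S⁴ → N → M`. What is OPEN is exactly Baykur–Sunukjian's
Remark 12 (1) ("assume the round 2-handles were attached independently, that is, `∂₋R_k` could be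
isotoped away from `∪ ∂₊R_i` … our proof does not guarantee this at all"): inside `N` the `M`-side
fillings must be moved off the `S⁴`-side core tori. This skeleton types that plan as THREE registered
stubs over a verbatim generalisation of the tree's surgery predicate to an arbitrary ambient 4-manifold
(§0; at ambient `S⁴` it is the tree predicate by `Iff.rfl`, theorem `isTorusLinkSurgeryIn_sphere_iff`):

* `stub_commonChild` (KNOWN at theorem level — Wall 1964 Thm 3 + `Θ₄ = 0` + Baykur–Sunukjian 2013
  Prop. 13 / Larson 2018 Thm. 20; XL to formalise): for every homotopy 4-sphere `M` there are `k` and a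
  smooth `N` which is a torus surgery on `S⁴` along a `k`-component LOCAL UNKNOTTED framed torus link
  (tubes inside pairwise disjoint smoothly embedded open balls, cores = the standard torus of revolution
  `stdTorus` of each ball) AND a torus surgery on `M` along a `k`-component local unknotted framed torus
  link, both with their gluing witnesses `(U, jA, jB)` / `(U', jA', jB')` exposed.
* `stub_disjoinCores` (OPEN — the heart; Baykur–Sunukjian Rem. 12 (1), Larson Question 1): for a homotopy
  4-sphere `M` and any such common child `N` (both local unknotted `k`-component presentations given),
  `N` can be RE-PRESENTED as a torus surgery on `S⁴` (witnesses `U₁, jA₁, jB₁`) and as a torus surgery on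
  `M` (witnesses `U₂, jA₂, jB₂`) so that every `M`-side filling `jB₂ j (T² × ℝ²)` lies inside the image
  `jA₁ U₁ = N ∖ (S⁴-side core tori)`: the two core links in `N` are disjoined. Why it might fail = the
  crux's own risk line (a later torus meeting an earlier core with non-zero algebraic intersection;
  Wall's diffeomorphism is not explicit). At theorem level it is implied by the crux (push the `S⁴`-side
  cores off into their fillings, which undoes round one inside the exterior image, then place a single
  generating link off the `k` balls), so it is not stronger than the crux modulo `stub_reverseUnite`-type
  gluing calculus; it is not cheaply the crux or the summit (BC3 probes).
* `stub_reverseUnite` (FOLKLORE gluing calculus; M–L): if `N` is a torus surgery on `S⁴` via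
  `(T, A, U, jA, jB)` and a torus surgery on `M` via `(T', A', U', jA', jB')` whose fillings satisfy
  `range (jB' j) ⊆ range jA`, then `M` is a torus surgery on `S⁴`: reverse the `M`-side presentation
  (`M` is the surgery on `N` along the filling tubes `jB' j` with exterior `range jA' = N ∖ cores'`,
  gluing map `jA'⁻¹`, fillings `T' j`, matrices `A'⁻¹` — the fibre relation is symmetric), shrink tubes
  radially so that the pulled-back tubes `jA⁻¹ ∘ jB' j` miss the (shrunk) first-round tubes, and compose
  the two open gluings (link `T ∪ jA⁻¹ ∘ jB'`, `n + n'` components).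

`SingleLinkGeneration_of : Sig.stub_commonChild → Sig.stub_disjoinCores → Sig.stub_reverseUnite →
SingleLinkGeneration` is PROVED (§3, pure logic: common child ↦ disjoined re-presentation ↦ reverse and
unite ↦ the crux's `∃ n T A` by `Iff.rfl`-unfolding); `singleLinkGeneration_of_stubs : SingleLinkGeneration`
is the crux by name modulo the three registered stubs. `lean check`: sorries ONLY in the three `stub_*`.

Hardest stub: `stub_disjoinCores` (the whole open content of Larson's Question 1 for homotopy spheres,
located in the explicit middle level `N ≅ # k(S¹ × S³ # S² × S²)`: separate the `M`-side core link from
the `S⁴`-side core link; obstruction = algebraic intersection numbers of the two `k`-component torus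
links in `H₂(N)`, then a Whitney-disc problem; levers = freedom in `k`, in Wall's diffeomorphism
(Wall 1964b: automorphisms of the form are realised after stabilising), in the matrices, handle slides).
`stub_commonChild` sits on the tree's Wall programme (`WallStabilisation.lean`, `ThetaFour.lean`,
`ConnectedSum*.lean`) plus one local Kirby-calculus fact (BS Prop. 13 / Larson Thm. 20) — XL but known;
`stub_reverseUnite` is gluing calculus in the open-gluing formalism of `TorusSurgery.lean` (M–L).

Honesty notes. (1) Every stub, like the crux itself (`SmoothPoincare4 → SingleLinkGeneration`: `n = 0`),
is a CONSEQUENCE of `SmoothPoincare4` at theorem level; none is cheaply equivalent to it or to the crux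
(BC3 probes below). (2) `stub_disjoinCores` lets BOTH presentations of the fixed child `N` be re-chosen
(weakest form that feeds `stub_reverseUnite`); its hypotheses (same `k`, locality, unknottedness) are
the structure the Wall–Baykur–Sunukjian child actually has — the `S⁴`-side cores then have explicit
geometric dual spheres and `N` is the explicit `# k(S¹ × S³ # S² × S²)`-type manifold. (3) Multiplicity
`0` of the local surgeries is NOT exported (it is framing-dependent as a matrix entry; the tube `T i`
carries the framing), so `stub_commonChild` stays true under any framing convention. (4) The generalised
predicate keeps the tree's text symbol for symbol (ambient `S⁴ ↦ X`); `N` Hausdorff / second countable is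
automatic from a presentation but kept as instance binders, as in the route items. (5) Degenerate cases:
`k = 0` forces `N ≅ S⁴ ≅ M` (consistent); `n' = 0` in `stub_reverseUnite` is transport of a presentation
along `M ≅ N`; `M = S⁴` inhabits every stub's hypotheses with `N = S⁴`, `k = 0`.

BC3 probes (registrar, 2026-08-17, files `bc/probe_*.lean` in the registrar's folder — §0–§1 of this file
verbatim plus one `example` per probe under `maxHeartbeats 400000`): 3 stubs × {`→ SingleLinkGeneration`,
`→ SmoothPoincare4`} × {`exact?`, `simpa`, `simpa [defs]`, `aesop`}: ALL FAIL (raw `lean check` output in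
the registrar's NOTES.md and in the crux evidence note). No stub is cheaply the crux or the summit.

Disproof used: none exists for this crux (`ledger crux ls stmt-SmoothPoincare4-3358`: no workfiles, no
`Disproof.lean`, no `Theorems/SingleLinkGeneration/Negative/*`, 2026-08-17); negatives index of the summit
consulted (`ledger negatives --problem SmoothPoincare4`: nothing on torus surgery). Grounder/refuter notes on
the item honoured: open-problem = Larson Q1 (grounder g18-7); "Baykur–Sunukjian fact needs a chain version
of IsTorusLinkSurgery (definition gap)" — §0 supplies exactly that generalisation, locally, verbatim.

Barriers (route technique_class: hyperbolic-Dehn-filling, torus-surgery, geometric-finiteness):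
`StableBarrierFour` / `OneStabilisationContractible` — ENGAGED AND NAMED: the line passes through Wall's
stable diffeomorphism on purpose (`stub_commonChild`) and puts the entire instability into one geometric
statement (`stub_disjoinCores`); it does not claim any stable invariant detects anything.
`HCobordismBarrierFour` — the h-cobordism enters only through Wall's theorem (known), no h-cobordism is
to be trivialised. `GaugeSumBarrierFour`, `TopologicalBarrierFour` — not engaged (positive side, no
invariant of `Σ` is evaluated). `CappellShanesonFamilyBarrier`, `CircleActionBarrierFour` — not engaged.
-/

noncomputable section

-- every `Summit.SmoothPoincare4.SmoothPoincare4.…` name repeats the summit = sub-problem segment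
-- (D-0017 layout); the duplicate is deliberate.
set_option linter.dupNamespace false
set_option linter.unusedVariables false

namespace Summit.SmoothPoincare4.SmoothPoincare4.Cruxes.SingleLinkGeneration.Birth

open scoped Manifold ContDiff Topology
open Set Function
open Literature.Topology.FourManifolds (circlePoint IsTorusLinkSurgery)
open Summit.SmoothPoincare4.SmoothPoincare4.Theses.HyperbolicTorusFillings (SingleLinkGeneration)

/-- Local notation: the round circle `S¹ ⊆ ℝ²` (Mathlib's analytic manifold, model `𝓡 1`). -/
local notation "𝕊¹" => (Metric.sphere (0 : EuclideanSpace ℝ (Fin 2)) 1)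
/-- Local notation: the round `4`-sphere `S⁴ ⊆ ℝ⁵` (model `𝓡 4`). -/
local notation "𝕊⁴" => (Metric.sphere (0 : EuclideanSpace ℝ (Fin 5)) 1)
/-- Local notation: the model plane `ℝ²` (normal fibre of a torus). -/
local notation "𝔼²" => EuclideanSpace ℝ (Fin 2)
/-- Local notation: the model space `ℝ⁴`. -/
local notation "𝔼⁴" => EuclideanSpace ℝ (Fin 4)
/-- Local notation: the torus `T² = S¹ × S¹` (model `(𝓡 1).prod (𝓡 1)`). -/
local notation "𝕋²" => (↥𝕊¹ × ↥𝕊¹)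

/-! ## §0 Vocabulary — the tree's torus-link-surgery predicate with a general ambient 4-manifold -/

/-- **Framed torus link** in a smooth 4-manifold `X` (the first three conjuncts of
`Literature.Topology.FourManifolds.IsTorusLinkSurgery`, ambient `S⁴ ↦ X`): the tubes
`T i : T² × ℝ² → X` are smooth embeddings with pairwise disjoint ranges and the regluing matrices
`A i ∈ GL(3, ℤ)` (`det = ±1`). [cite: Larson2016, §2] -/
def IsFramedTorusLink (X : Type*) [TopologicalSpace X] [ChartedSpace 𝔼⁴ X] (n : ℕ)
    (T : Fin n → 𝕋² × 𝔼² → X) (A : Fin n → Matrix (Fin 3) (Fin 3) ℤ) : Prop :=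
  (∀ i, Manifold.IsSmoothEmbedding (((𝓡 1).prod (𝓡 1)).prod 𝓘(ℝ, EuclideanSpace ℝ (Fin 2))) (𝓡 4) ∞
  (T i)) ∧ Pairwise (fun i j => Disjoint (Set.range (T i)) (Set.range (T j))) ∧ (∀ i, (A i).det = 1
  ∨ (A i).det = -1)

/-- **The gluing clauses, witnesses exposed** (the body of the `∃ U jA jB` of
`Literature.Topology.FourManifolds.IsTorusLinkSurgery`, ambient `S⁴ ↦ X`, VERBATIM otherwise): `X'` is
the open gluing of the core-complement `U = X ∖ ⋃ᵢ T i (T² × {0})` (via `jA`) with `n` copies of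
`T² × ℝ²` (via `jB i`), jointly covering `X'`, the `jB i` with pairwise disjoint ranges, and
`jA a = jB i b` iff `b = ((circlePoint θ₁, circlePoint θ₂), t • circlePoint θ₃)`, `t > 0`, and
`a = T i (ψ_(A i) b)` for the linear `GL(3, ℤ)` regluing `ψ_A` of `T³ × (0, ∞)`. The `X`-SIDE CORES in
`X'` are the tori `jB i (T² × {0})`, and `range jA = X' ∖ ⋃ᵢ jB i (T² × {0})`.
[cite: Larson2016, §2 (torus surgery, gluing by GL(3,ℤ))] -/
def IsTorusLinkSurgeryVia (X : Type*) [TopologicalSpace X] [ChartedSpace 𝔼⁴ X]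
    (X' : Type*) [TopologicalSpace X'] [ChartedSpace 𝔼⁴ X'] (n : ℕ)
    (T : Fin n → 𝕋² × 𝔼² → X) (A : Fin n → Matrix (Fin 3) (Fin 3) ℤ)
    (U : TopologicalSpace.Opens X) (jA : ↥U → X') (jB : Fin n → 𝕋² × 𝔼² → X') : Prop :=
  (U : Set X) = (⋃ i, Set.range (fun x : (↥(Metric.sphere (0 : EuclideanSpace ℝ (Fin 2)) 1) ×
  ↥(Metric.sphere (0 : EuclideanSpace ℝ (Fin 2)) 1)) => T i (x, 0)))ᶜ ∧
  Manifold.IsSmoothEmbedding (𝓡 4) (𝓡 4) ∞ jA ∧ IsOpen (Set.range jA) ∧ (∀ i,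
  Manifold.IsSmoothEmbedding (((𝓡 1).prod (𝓡 1)).prod 𝓘(ℝ, EuclideanSpace ℝ (Fin 2))) (𝓡 4) ∞ (jB i)
  ∧ IsOpen (Set.range (jB i))) ∧ Set.range jA ∪ (⋃ i, Set.range (jB i)) = Set.univ ∧ Pairwise (fun i
  j => Disjoint (Set.range (jB i)) (Set.range (jB j))) ∧ ∀ (i : Fin n) (a : ↥U) (b :
  (↥(Metric.sphere (0 : EuclideanSpace ℝ (Fin 2)) 1) × ↥(Metric.sphere (0 : EuclideanSpace ℝ (Fin
  2)) 1)) × EuclideanSpace ℝ (Fin 2)), (jA a = jB i b ↔ ∃ θ₁ θ₂ θ₃ t : ℝ, 0 < t ∧ b =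
  ((Literature.Topology.FourManifolds.circlePoint (θ₁),
  Literature.Topology.FourManifolds.circlePoint (θ₂)), t •
  ((Literature.Topology.FourManifolds.circlePoint (θ₃) : ↥(Metric.sphere (0 : EuclideanSpace ℝ (Fin
  2)) 1)) : EuclideanSpace ℝ (Fin 2))) ∧ (a : X) = T i
  ((Literature.Topology.FourManifolds.circlePoint ((A i 0 0 : ℝ) * θ₁ + (A i 0 1 : ℝ) * θ₂ + (A i
  0 2 : ℝ) * θ₃), Literature.Topology.FourManifolds.circlePoint ((A i 1 0 : ℝ) * θ₁ + (A i 1 1 : ℝ)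
  * θ₂ + (A i 1 2 : ℝ) * θ₃)), t • ((Literature.Topology.FourManifolds.circlePoint ((A i 2 0 : ℝ) *
  θ₁ + (A i 2 1 : ℝ) * θ₂ + (A i 2 2 : ℝ) * θ₃) : ↥(Metric.sphere (0 : EuclideanSpace ℝ (Fin 2)) 1))
  : EuclideanSpace ℝ (Fin 2))))

/-- **Torus surgery on a framed link of tori in a general smooth 4-manifold `X`**: `X'` IS the result
of the simultaneous torus surgery on `X` along `(T, A)` — the tree's `IsTorusLinkSurgery (𝓡 4) X' n T A`
with its ambient `S⁴` replaced by `X` (the "chain version" recorded as a definition gap by the grounder of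
this item; kept local to this skeleton). At `X = S⁴` it is the tree predicate (`isTorusLinkSurgeryIn_sphere_iff`,
`Iff.rfl`). [cite: Larson2016, §2] -/
def IsTorusLinkSurgeryIn (X : Type*) [TopologicalSpace X] [ChartedSpace 𝔼⁴ X]
    (X' : Type*) [TopologicalSpace X'] [ChartedSpace 𝔼⁴ X'] (n : ℕ)
    (T : Fin n → 𝕋² × 𝔼² → X) (A : Fin n → Matrix (Fin 3) (Fin 3) ℤ) : Prop :=
  (∀ i, Manifold.IsSmoothEmbedding (((𝓡 1).prod (𝓡 1)).prod 𝓘(ℝ, EuclideanSpace ℝ (Fin 2))) (𝓡 4) ∞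
  (T i)) ∧ Pairwise (fun i j => Disjoint (Set.range (T i)) (Set.range (T j))) ∧ (∀ i, (A i).det = 1
  ∨ (A i).det = -1) ∧ ∃ (U : TopologicalSpace.Opens X) (jA : ↥U → X') (jB : Fin n → 𝕋² × 𝔼² → X'),
  IsTorusLinkSurgeryVia X X' n T A U jA jB

/-- At ambient `S⁴` the generalised predicate IS the tree's `IsTorusLinkSurgery (𝓡 4)` — by `Iff.rfl`
(the text is verbatim). [folklore] -/
theorem isTorusLinkSurgeryIn_sphere_iff (M : Type) [TopologicalSpace M] [ChartedSpace 𝔼⁴ M] (n : ℕ)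
    (T : Fin n → 𝕋² × 𝔼² → 𝕊⁴) (A : Fin n → Matrix (Fin 3) (Fin 3) ℤ) :
    IsTorusLinkSurgeryIn 𝕊⁴ M n T A ↔ IsTorusLinkSurgery (𝓡 4) M n T A :=
  Iff.rfl

/-- Framed link plus exposed gluing witnesses give the relational surgery predicate (sanity). -/
theorem isTorusLinkSurgeryIn_of_via {X : Type*} [TopologicalSpace X] [ChartedSpace 𝔼⁴ X]
    {X' : Type*} [TopologicalSpace X'] [ChartedSpace 𝔼⁴ X'] {n : ℕ}
    {T : Fin n → 𝕋² × 𝔼² → X} {A : Fin n → Matrix (Fin 3) (Fin 3) ℤ}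
    {U : TopologicalSpace.Opens X} {jA : ↥U → X'} {jB : Fin n → 𝕋² × 𝔼² → X'}
    (hL : IsFramedTorusLink X n T A) (hV : IsTorusLinkSurgeryVia X X' n T A U jA jB) :
    IsTorusLinkSurgeryIn X X' n T A :=
  ⟨hL.1, hL.2.1, hL.2.2, U, jA, jB, hV⟩

/-- **The standard (unknotted) torus of `ℝ⁴`**: the torus of revolution with radii `2, 1` in
`ℝ³ × {0} ⊆ ℝ⁴`, `((cos θ, sin θ), (cos φ, sin φ)) ↦ ((2 + cos φ) cos θ, (2 + cos φ) sin θ, sin φ, 0)`.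
It bounds the solid torus of revolution, so its image under any ball embedding is the unknotted torus of
Larson 2018 §5 ("the unique torus in `S⁴` that bounds a solid torus `S¹ × D²`"). [cite: Larson2016, §5] -/
def stdTorus (x : 𝕋²) : 𝔼⁴ :=
  WithLp.toLp 2 ![(2 + (x.2 : 𝔼²) 0) * (x.1 : 𝔼²) 0, (2 + (x.2 : 𝔼²) 0) * (x.1 : 𝔼²) 1, (x.2 : 𝔼²) 1, 0]

/-- **Local unknotted link**: the tubes `T i` lie in pairwise disjoint smoothly embedded open balls
`β i : ℝ⁴ ↪ X` and the core of `T i` IS the standard torus of its ball, `T i (x, 0) = β i (stdTorus x)`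
(the shape of the Baykur–Sunukjian stabilising surgeries: log transforms "in a 4-ball" along the
unknotted torus; Baykur–Sunukjian 2013 Prop. 13, Larson 2018 Thm. 20). [cite: Larson2016, §5, Thm. 20] -/
def IsLocalUnknottedLink (X : Type*) [TopologicalSpace X] [ChartedSpace 𝔼⁴ X] (n : ℕ)
    (T : Fin n → 𝕋² × 𝔼² → X) : Prop :=
  ∃ β : Fin n → 𝔼⁴ → X, (∀ i, Manifold.IsSmoothEmbedding 𝓘(ℝ, EuclideanSpace ℝ (Fin 4)) (𝓡 4) ∞ (β i)
    ∧ IsOpen (Set.range (β i))) ∧ Pairwise (fun i j => Disjoint (Set.range (β i)) (Set.range (β j))) ∧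
    (∀ i, Set.range (T i) ⊆ Set.range (β i)) ∧ ∀ i x, T i (x, 0) = β i (stdTorus x)

/-! ## §1 The stub SIGNATURES (`Sig.stub_<name>`; the skeleton audit reads the hypotheses of
`SingleLinkGeneration_of` BY NAME, heads = stub names) -/

/-- **STUB 1 — THE WALL–BAYKUR–SUNUKJIAN COMMON CHILD** (KNOWN at theorem level; XL). For every
smooth homotopy 4-sphere `M` there are `k : ℕ` and a smooth 4-manifold `N` (Hausdorff, second countable,
`C^∞` on `𝓡 4`) which is SIMULTANEOUSLY (i) the torus surgery on `S⁴` along a `k`-component local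
unknotted framed torus link `(T, A)`, with gluing witnesses `(U, jA, jB)`, and (ii) the torus surgery on
`M` along a `k`-component local unknotted framed torus link `(T', A')`, with witnesses `(U', jA', jB')`.
Proof in print: `M # k(S² × S²) ≅ # k(S² × S²)` (Wall 1964 Thm 3 + `Θ₄ = 0`; tree
`exists_isStabilization_sphere_of_homotopySphere_four`), hence `M # k W ≅ S⁴ # k W =: N`,
`W = S² × S² # S¹ × S³` (sum both sides with `k` copies of `S¹ × S³`; `W` is amphicheiral); `X # W` is
the multiplicity-`0` surgery on the unknotted torus in a ball of `X` (Baykur–Sunukjian 2013 Prop. 13;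
Larson 2018 Thm. 20 with `ab` even), and `k` of them in disjoint balls are one simultaneous surgery; the
`M`-side presentation of `M # k W` is transported to `N` through Wall's diffeomorphism (balls go to
balls, tubes to tubes). Why it might fail: only as typed (it is in print); the tube parametrisations
absorb framings into `A`, `A'`. [Wall1964 Thm. 3; KervaireMilnorAnnals1963 Thm. 1.1;
BaykurSunukjian2013 = arXiv:1009.0514 Prop. 13, Cor. 10–11; Larson2016 = arXiv:1502.06834 Thm. 20] -/
def Sig.stub_commonChild : Prop :=
  ∀ (M : Type) [TopologicalSpace M] [T2Space M] [SecondCountableTopology M] [ChartedSpace 𝔼⁴ M]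
    [IsManifold (𝓡 4) ∞ M], ContinuousMap.HomotopyEquiv M 𝕊⁴ →
    ∃ (k : ℕ) (N : Type) (_ : TopologicalSpace N) (_ : T2Space N) (_ : SecondCountableTopology N)
      (_ : ChartedSpace 𝔼⁴ N) (_ : IsManifold (𝓡 4) ∞ N)
      (T : Fin k → 𝕋² × 𝔼² → 𝕊⁴) (A : Fin k → Matrix (Fin 3) (Fin 3) ℤ)
      (U : TopologicalSpace.Opens 𝕊⁴) (jA : ↥U → N) (jB : Fin k → 𝕋² × 𝔼² → N)
      (T' : Fin k → 𝕋² × 𝔼² → M) (A' : Fin k → Matrix (Fin 3) (Fin 3) ℤ)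
      (U' : TopologicalSpace.Opens M) (jA' : ↥U' → N) (jB' : Fin k → 𝕋² × 𝔼² → N),
      (IsFramedTorusLink 𝕊⁴ k T A ∧ IsLocalUnknottedLink 𝕊⁴ k T ∧
        IsTorusLinkSurgeryVia 𝕊⁴ N k T A U jA jB) ∧
      (IsFramedTorusLink M k T' A' ∧ IsLocalUnknottedLink M k T' ∧
        IsTorusLinkSurgeryVia M N k T' A' U' jA' jB')

/-- **STUB 2 — DISJOIN THE TWO CORE LINKS IN THE COMMON CHILD** (OPEN — the heart; Baykur–Sunukjian
2013 Remark 12 (1); Larson 2018 Question 1 for homotopy spheres, in the middle level). Let `M` be a smooth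
homotopy 4-sphere and `N` a common child as in stub 1: a torus surgery on `S⁴` along a `k`-component local
unknotted link (witnesses `U, jA, jB`; the `S⁴`-SIDE CORES are the tori `jB i (T² × {0})`, and
`range jA = N ∖ cores`) and a torus surgery on `M` along a `k`-component local unknotted link. CLAIM:
`N` admits a presentation as a torus surgery on `S⁴` (any link `T₁`, witnesses `U₁, jA₁, jB₁`) and a
presentation as a torus surgery on `M` (any link `T₂`, witnesses `U₂, jA₂, jB₂`) such that every `M`-side
filling lies in the `S⁴`-side exterior image: `range (jB₂ j) ⊆ range jA₁`. Informal content: in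
`N ≅ # k(S¹ × S³ # S² × S²)` separate the `M`-side core tori (images of the belt tori of the `k`
stabilising surgeries of `M` under Wall's diffeomorphism) from the `S⁴`-side core tori, using the
freedom in `k`, in Wall's diffeomorphism (post-composition with diffeomorphisms of `N` realising
automorphisms of `H₂`), in the matrices and in handle slides; obstruction = the `k × k` algebraic
intersection numbers of the two torus links, then Whitney discs. Why it might fail: the route's own
risk line for this crux (the second-round tori may meet the first-round cores essentially for every
choice) — this IS Larson's Question 1 for homotopy spheres, located. Not stronger than the crux at
theorem level (push-offs of the `S⁴`-side cores into their fillings undo round one inside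
`range jA`; a single generating link is isotoped off the `k` balls). Size: open-problem.
[BaykurSunukjian2013 Rem. 12 (1), Question 15; Larson2016 §1 Question 1, §4; Wall1964b (diffeomorphisms);
FreedmanQuinn1990 §1 (Whitney discs)] -/
def Sig.stub_disjoinCores : Prop :=
  ∀ (M : Type) [TopologicalSpace M] [T2Space M] [SecondCountableTopology M] [ChartedSpace 𝔼⁴ M]
    [IsManifold (𝓡 4) ∞ M], ContinuousMap.HomotopyEquiv M 𝕊⁴ →
    ∀ (k : ℕ) (N : Type) [TopologicalSpace N] [T2Space N] [SecondCountableTopology N]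
      [ChartedSpace 𝔼⁴ N] [IsManifold (𝓡 4) ∞ N]
      (T : Fin k → 𝕋² × 𝔼² → 𝕊⁴) (A : Fin k → Matrix (Fin 3) (Fin 3) ℤ)
      (U : TopologicalSpace.Opens 𝕊⁴) (jA : ↥U → N) (jB : Fin k → 𝕋² × 𝔼² → N)
      (T' : Fin k → 𝕋² × 𝔼² → M) (A' : Fin k → Matrix (Fin 3) (Fin 3) ℤ)
      (U' : TopologicalSpace.Opens M) (jA' : ↥U' → N) (jB' : Fin k → 𝕋² × 𝔼² → N),
      IsFramedTorusLink 𝕊⁴ k T A ∧ IsLocalUnknottedLink 𝕊⁴ k T ∧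
        IsTorusLinkSurgeryVia 𝕊⁴ N k T A U jA jB →
      IsFramedTorusLink M k T' A' ∧ IsLocalUnknottedLink M k T' ∧
        IsTorusLinkSurgeryVia M N k T' A' U' jA' jB' →
      ∃ (n₁ : ℕ) (T₁ : Fin n₁ → 𝕋² × 𝔼² → 𝕊⁴) (A₁ : Fin n₁ → Matrix (Fin 3) (Fin 3) ℤ)
        (U₁ : TopologicalSpace.Opens 𝕊⁴) (jA₁ : ↥U₁ → N) (jB₁ : Fin n₁ → 𝕋² × 𝔼² → N)
        (n₂ : ℕ) (T₂ : Fin n₂ → 𝕋² × 𝔼² → M) (A₂ : Fin n₂ → Matrix (Fin 3) (Fin 3) ℤ)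
        (U₂ : TopologicalSpace.Opens M) (jA₂ : ↥U₂ → N) (jB₂ : Fin n₂ → 𝕋² × 𝔼² → N),
        IsFramedTorusLink 𝕊⁴ n₁ T₁ A₁ ∧ IsTorusLinkSurgeryVia 𝕊⁴ N n₁ T₁ A₁ U₁ jA₁ jB₁ ∧
        IsFramedTorusLink M n₂ T₂ A₂ ∧ IsTorusLinkSurgeryVia M N n₂ T₂ A₂ U₂ jA₂ jB₂ ∧
        ∀ j, Set.range (jB₂ j) ⊆ Set.range jA₁

/-- **STUB 3 — REVERSE AND UNITE** (folklore gluing calculus in the open-gluing formalism; M–L). If `N`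
is a torus surgery on `S⁴` via `(T, A, U, jA, jB)` and ALSO a torus surgery on `M` via
`(T', A', U', jA', jB')`, and every `M`-side filling lies in the `S⁴`-side exterior image
(`range (jB' j) ⊆ range jA`, i.e. misses the `S⁴`-side cores), then `M` is a torus surgery on `S⁴`
(along `n + n'` tori). Proof sketch: (a) REVERSE — `M` is the torus surgery on `N` along the filling
tubes `jB' j`: exterior `N ∖ ⋃ⱼ jB' j (T² × {0}) = range jA'`, gluing map `(jA')⁻¹`, fillings `T' j`,
matrices `(A' j)⁻¹` (the fibre relation `a = T' j (ψ_A b)` is equivalent to `b = ψ_{A⁻¹} (T' j⁻¹ a)`,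
and `t > 0` exactly off the cores); (b) SHRINK — re-present both rounds with radially shrunk tubes
(`ψ_A` commutes with radial reparametrisation), so that the compact closures of the new `M`-side tubes,
which lie in `range jA = N ∖ cores`, miss the shrunk `S⁴`-side tubes (compactness in Hausdorff `N`);
(c) UNITE — link `T ∪ (jA⁻¹ ∘ jB')` in `S⁴`, exterior `U ∩ jA⁻¹(range jA')`, gluing `jA' ∘ … ∘ jA`…
precisely `(jA')⁻¹`-reversed: `M`-valued gluing `x ↦ (reverse gluing) (jA x)`, fillings
`(reverse of jB i)` and `T' j`; the fibre relations hold piecewise by injectivity of `jA`, `jA'`.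
Why it might fail: only as typed (bookkeeping of `Manifold.IsSmoothEmbedding` for compositions /
inverses on open ranges; Mathlib has `IsSmoothEmbedding.of_opens`, composition is `proof_wanted`).
[Larson2016 §2; GompfStipsicz1999 §8.3 (log transforms), §4 (gluing); Iwase1988 §1] -/
def Sig.stub_reverseUnite : Prop :=
  ∀ (N : Type) [TopologicalSpace N] [T2Space N] [SecondCountableTopology N] [ChartedSpace 𝔼⁴ N]
    [IsManifold (𝓡 4) ∞ N]
    (M : Type) [TopologicalSpace M] [T2Space M] [SecondCountableTopology M] [ChartedSpace 𝔼⁴ M]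
    [IsManifold (𝓡 4) ∞ M]
    (n : ℕ) (T : Fin n → 𝕋² × 𝔼² → 𝕊⁴) (A : Fin n → Matrix (Fin 3) (Fin 3) ℤ)
    (U : TopologicalSpace.Opens 𝕊⁴) (jA : ↥U → N) (jB : Fin n → 𝕋² × 𝔼² → N)
    (n' : ℕ) (T' : Fin n' → 𝕋² × 𝔼² → M) (A' : Fin n' → Matrix (Fin 3) (Fin 3) ℤ)
    (U' : TopologicalSpace.Opens M) (jA' : ↥U' → N) (jB' : Fin n' → 𝕋² × 𝔼² → N),
    IsFramedTorusLink 𝕊⁴ n T A → IsTorusLinkSurgeryVia 𝕊⁴ N n T A U jA jB →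
    IsFramedTorusLink M n' T' A' → IsTorusLinkSurgeryVia M N n' T' A' U' jA' jB' →
    (∀ j, Set.range (jB' j) ⊆ Set.range jA) →
    ∃ (m : ℕ) (T₀ : Fin m → 𝕋² × 𝔼² → 𝕊⁴) (A₀ : Fin m → Matrix (Fin 3) (Fin 3) ℤ),
      IsTorusLinkSurgery (𝓡 4) M m T₀ A₀

/-! ## §2 The registered stubs (the ONLY `sorry`s of this file) -/

/-- Registered stub 1 (KNOWN at theorem level — Wall + `Θ₄ = 0` + Baykur–Sunukjian Prop. 13; XL): the
common child. See `Sig.stub_commonChild`. -/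
theorem stub_commonChild : Sig.stub_commonChild := by
  sorry

/-- Registered stub 2 (OPEN, the heart): disjoin the two core links in the common child. See
`Sig.stub_disjoinCores`. -/
theorem stub_disjoinCores : Sig.stub_disjoinCores := by
  sorry

/-- Registered stub 3 (folklore, M–L): reverse the `M`-side surgery and unite the two rounds. See
`Sig.stub_reverseUnite`. -/
theorem stub_reverseUnite : Sig.stub_reverseUnite := by
  sorry

/-! ## §3 The composition — the crux BY NAME from the three stubs (real proof, no `sorry`) -/

/-- **Skeleton theorem.** Common child, disjoining and reverse-and-unite imply the crux
`Theses.HyperbolicTorusFillings.SingleLinkGeneration` BY NAME. Fix `Σ = (M, e)`. Stub 1 gives the common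
child `N` with its two local unknotted `k`-component presentations; stub 2 re-presents `N` over `S⁴` and
over `M` with the `M`-side fillings inside the `S⁴`-side exterior image; stub 3 reverses and unites:
`M` is a torus surgery on `S⁴`, which is the crux's `∃ n T A` (the crux inlines
`IsTorusLinkSurgery (𝓡 4) M n T A` verbatim, `isTorusLinkSurgery_iff`). -/
theorem SingleLinkGeneration_of :
    Sig.stub_commonChild → Sig.stub_disjoinCores → Sig.stub_reverseUnite →
      Summit.SmoothPoincare4.SmoothPoincare4.Theses.HyperbolicTorusFillings.SingleLinkGeneration := by
  intro hChild hDisjoin hUnite M _ _ _ _ _ e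
  -- stub 1: the Wall–Baykur–Sunukjian common child `N` and its two presentations
  obtain ⟨k, N, _, _, _, _, _, T, A, U, jA, jB, T', A', U', jA', jB', hS, hM⟩ := hChild M e
  -- stub 2: re-present with the `M`-side fillings off the `S⁴`-side cores
  obtain ⟨n₁, T₁, A₁, U₁, jA₁, jB₁, n₂, T₂, A₂, U₂, jA₂, jB₂, hL₁, hV₁, hL₂, hV₂, hoff⟩ :=
    hDisjoin M e k N T A U jA jB T' A' U' jA' jB' hS hM
  -- stub 3: reverse the `M`-side surgery and unite the two rounds
  obtain ⟨m, T₀, A₀, h⟩ := hUnite N M n₁ T₁ A₁ U₁ jA₁ jB₁ n₂ T₂ A₂ U₂ jA₂ jB₂ hL₁ hV₁ hL₂ hV₂ hoff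
  exact ⟨m, T₀, A₀, (Literature.Topology.FourManifolds.isTorusLinkSurgery_iff M m T₀ A₀).1 h⟩

/-- The crux by name, closed modulo the three registered stubs (its axiom closure contains `sorryAx`
through the stubs only; `SingleLinkGeneration_of` itself is sorry-free). -/
theorem singleLinkGeneration_of_stubs :
    Summit.SmoothPoincare4.SmoothPoincare4.Theses.HyperbolicTorusFillings.SingleLinkGeneration :=
  SingleLinkGeneration_of stub_commonChild stub_disjoinCores stub_reverseUnite

end Summit.SmoothPoincare4.SmoothPoincare4.Cruxes.SingleLinkGeneration.Birth

end
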